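import Summits.KontsevichZagierPeriods.KontsevichZagierPeriods.Theses.FurushoPentagon
import Literature.NumberTheory.Transcendental.KZCalculusProofs
import Literature.NumberTheory.Transcendental.SemialgebraicMapsProofs
import Literature.NumberTheory.Transcendental.MultipleZeta

/-!
# drefute — `stub_peakExists` of line `dilation-homotopy-transposition` (crux stmt-KontsevichZagierPeriods-3930)

The peak `[{(u,x,λ) ∈ (0,1)ⁿ⁺² | u < λ}, K(σ_λ x)/(1−u)]` is an integral representation: absolute
integrability by Tonelli along `λ` (the kernel is `≥ 0`) and the fundamental theorem of calculus
`∫_u^1 K(σ_λ x) dλ = f(x) − u f(σ_u x)`, against the integrable stuffle side `B`.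
-/

noncomputable section
set_option linter.dupNamespace false
open Set MeasureTheory MvPolynomial
open Literature.NumberTheory.Transcendental
open Literature.ModelTheory.ExponentialFields (IsSemialgebraic)

namespace Summit.KontsevichZagierPeriods.KontsevichZagierPeriods.Cruxes.HoffmanRelationInKZ.DrefutePeak

variable {n : ℕ}

/-! ### Local copies of the coordinate helpers of `DrefuteDescents` (kept self-contained) -/

theorem castSucc_zero' : ((0 : Fin (n + 1)).castSucc : Fin (n + 2)) = 0 := by
  ext; simp

@[simp] theorem snoc_zero'' (y : Fin (n + 1) → ℝ) (t : ℝ) :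
    (Fin.snoc y t : Fin (n + 2) → ℝ) 0 = y 0 := by
  rw [← castSucc_zero', Fin.snoc_castSucc]

/-- `σ 1 = id`, `σ` the shear of the corner coordinate. -/
theorem shear_one (σ : ℝ → (Fin n → ℝ) → (Fin n → ℝ))
    (hσ : ∀ (c : ℝ) (x : Fin n → ℝ) (j : Fin n), σ c x j = if (j : ℕ) = 0 then c * x j else x j)
    (x : Fin n → ℝ) : σ 1 x = x := by
  funext j; rw [hσ]; split_ifs <;> simp

/-- The peak integrand `K(σ_λ x)/(1 − u)` in the coordinates `z = (u, x, λ)`. -/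
def peakΦ (K : (Fin n → ℝ) → ℝ) (σ : ℝ → (Fin n → ℝ) → (Fin n → ℝ)) (z : Fin (n + 2) → ℝ) : ℝ :=
  K (σ (z (Fin.last (n + 1))) (Fin.tail (Fin.init z))) / (1 - z 0)

theorem peakΦ_snoc (K : (Fin n → ℝ) → ℝ) (σ : ℝ → (Fin n → ℝ) → (Fin n → ℝ)) (y : Fin (n + 1) → ℝ) (t : ℝ) :
    peakΦ K σ (Fin.snoc y t) = K (σ t (Fin.tail y)) / (1 - y 0) := by
  simp [peakΦ]

/-- The big band `{(u,x) ∈ (0,1)ⁿ⁺¹, 0 ≤ λ ≤ 1}` of the dilation-calculus stub. -/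
def bigBand (n : ℕ) : Set (Fin (n + 2) → ℝ) :=
  {z | (∀ i, Fin.init z i ∈ Ioo (0:ℝ) 1) ∧ 0 ≤ z (Fin.last (n + 1)) ∧ z (Fin.last (n + 1)) ≤ 1}

/-- The open peak domain `{z ∈ (0,1)ⁿ⁺² | u < λ}`. -/
def peakDom (n : ℕ) : Set (Fin (n + 2) → ℝ) :=
  {z | (∀ i, z i ∈ Ioo (0:ℝ) 1) ∧ z 0 < z (Fin.last (n + 1))}

theorem isSemialgebraic_peakDom : IsSemialgebraic ℚ (peakDom n) := by
  have h1 : IsSemialgebraic ℚ {z : Fin (n + 2) → ℝ | ∀ i, 0 < z i} := by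
    have : {z : Fin (n + 2) → ℝ | ∀ i, 0 < z i} = ⋂ i ∈ (Finset.univ : Finset (Fin (n + 2))),
        {z | 0 < aeval z (X i : MvPolynomial (Fin (n + 2)) ℚ)} := by
      ext z; simp
    rw [this]
    exact IsSemialgebraic.biInter _ _ fun i _ =>
      Literature.ModelTheory.ExponentialFields.isSemialgebraic_setOf_eval_pos (k := ℚ) _
  have h2 : IsSemialgebraic ℚ {z : Fin (n + 2) → ℝ | ∀ i, z i < 1} := by
    have : {z : Fin (n + 2) → ℝ | ∀ i, z i < 1} = ⋂ i ∈ (Finset.univ : Finset (Fin (n + 2))),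
        {z | 0 < aeval z (1 - X i : MvPolynomial (Fin (n + 2)) ℚ)} := by
      ext z; simp [sub_pos]
    rw [this]
    exact IsSemialgebraic.biInter _ _ fun i _ =>
      Literature.ModelTheory.ExponentialFields.isSemialgebraic_setOf_eval_pos (k := ℚ) _
  have h3 : IsSemialgebraic ℚ {z : Fin (n + 2) → ℝ | z 0 < z (Fin.last (n + 1))} := by
    have : {z : Fin (n + 2) → ℝ | z 0 < z (Fin.last (n + 1))} =
        {z | 0 < aeval z (X (Fin.last (n + 1)) - X 0 : MvPolynomial (Fin (n + 2)) ℚ)} := by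
      ext z; simp [sub_pos]
    rw [this]
    exact Literature.ModelTheory.ExponentialFields.isSemialgebraic_setOf_eval_pos (k := ℚ) _
  have : peakDom n = ({z | ∀ i, 0 < z i} ∩ {z | ∀ i, z i < 1}) ∩ {z | z 0 < z (Fin.last (n + 1))} := by
    ext z
    simp only [peakDom, mem_Ioo, mem_setOf_eq, mem_inter_iff, forall_and]
  rw [this]
  exact (h1.inter h2).inter h3

theorem peakDom_subset_bigBand : peakDom n ⊆ bigBand n := fun _ hz =>
  ⟨fun i => hz.1 i.castSucc, (hz.1 _).1.le, (hz.1 _).2.le⟩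

section Data

variable (f : (Fin n → ℝ) → ℝ) (K : (Fin n → ℝ) → ℝ) (σ : ℝ → (Fin n → ℝ) → (Fin n → ℝ))

/-- **The peak exists** (general `f, K, σ` under the dilation-calculus facts and an integrable
stuffle side). -/
theorem peak_exists
    (hσ : ∀ (c : ℝ) (x : Fin n → ℝ) (j : Fin n), σ c x j = if (j : ℕ) = 0 then c * x j else x j)
    (hder : ∀ x : Fin n → ℝ, (∀ i, x i ∈ Ioo (0:ℝ) 1) → ∀ l ∈ Ioo (0:ℝ) 1,
      HasDerivAt (fun l : ℝ => l * f (σ l x)) (K (σ l x)) l)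
    (hcontF : ∀ x : Fin n → ℝ, (∀ i, x i ∈ Ioo (0:ℝ) 1) → ContinuousOn (fun l : ℝ => l * f (σ l x)) (Icc 0 1))
    (hcontK : ∀ x : Fin n → ℝ, (∀ i, x i ∈ Ioo (0:ℝ) 1) → ContinuousOn (fun l : ℝ => K (σ l x)) (Icc 0 1))
    (hKnn : ∀ x : Fin n → ℝ, (∀ i, x i ∈ Ioo (0:ℝ) 1) → ∀ l ∈ Icc (0:ℝ) 1, 0 ≤ K (σ l x))
    (hsaK : IsSemialgebraicFunOn ℚ (bigBand n) (peakΦ K σ))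
    (rB : KZ.IntegralRep (n + 1))
    (hrB : rB.domain = {y | ∀ i, y i ∈ Ioo (0:ℝ) 1} ∧
      EqOn rB.integrand (fun y => (f (Fin.tail y) - y 0 * f (σ (y 0) (Fin.tail y))) / (1 - y 0)) rB.domain) :
    ∃ R : KZ.IntegralRep (n + 2), R.domain = {z | (∀ i, z i ∈ Ioo (0:ℝ) 1) ∧ z 0 < z (Fin.last (n + 1))} ∧
      EqOn R.integrand (peakΦ K σ) R.domain := by
  -- notation
  set D : Set (Fin (n + 2) → ℝ) := peakDom n with hD
  set cube : Set (Fin (n + 1) → ℝ) := {y | ∀ i, y i ∈ Ioo (0:ℝ) 1} with hcube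
  set B : (Fin (n + 1) → ℝ) → ℝ := fun y => (f (Fin.tail y) - y 0 * f (σ (y 0) (Fin.tail y))) / (1 - y 0)
    with hB
  have hDsa : IsSemialgebraic ℚ D := isSemialgebraic_peakDom
  have hDm : MeasurableSet D := Literature.ModelTheory.ExponentialFields.IsSemialgebraic.measurableSet_holds hDsa
  have hcube_m : MeasurableSet cube := by
    rw [← hrB.1]; exact KZ.IntegralRep.measurableSet_domain_holds rB
  have hsaD : IsSemialgebraicFunOn ℚ D (peakΦ K σ) := hsaK.mono peakDom_subset_bigBand hDsa
  -- the integrand, extended by zero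
  set Φ' : (Fin (n + 2) → ℝ) → ℝ := D.indicator (peakΦ K σ) with hΦ'
  have hΦ'meas : Measurable Φ' := by
    refine measurable_of_restrict_of_restrict_compl hDm ?_ ?_
    · have : D.restrict Φ' = D.restrict (peakΦ K σ) := by
        funext ⟨z, hz⟩; simp [hΦ', indicator_of_mem hz]
      rw [this]
      exact IsSemialgebraicFunOn.measurable_holds hsaD
    · have : Dᶜ.restrict Φ' = fun _ => 0 := by
        funext ⟨z, hz⟩; simp [hΦ', indicator_of_notMem (show z ∉ D from hz)]
      rw [this]
      exact measurable_const
  have hΦ'nn : ∀ z, 0 ≤ Φ' z := by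
    intro z
    by_cases hz : z ∈ D
    · rw [hΦ', indicator_of_mem hz, peakΦ]
      have hx : ∀ i, Fin.tail (Fin.init z) i ∈ Ioo (0:ℝ) 1 := fun i => hz.1 _
      have hl : z (Fin.last (n + 1)) ∈ Icc (0:ℝ) 1 := ⟨(hz.1 _).1.le, (hz.1 _).2.le⟩
      exact div_nonneg (hKnn _ hx _ hl) (sub_pos.mpr (hz.1 0).2).le
    · rw [hΦ', indicator_of_notMem hz]
  -- fibre computation: for `y ∈ cube`, `λ ↦ Φ'(y, λ)` is the indicator of `(y₀, 1)` times the kernel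
  have hfibre : ∀ y ∈ cube, ∀ t : ℝ,
      Φ' (Fin.snoc y t) = (Ioo (y 0) 1).indicator (fun t => K (σ t (Fin.tail y)) / (1 - y 0)) t := by
    intro y hy t
    by_cases ht : t ∈ Ioo (y 0) 1
    · have hmem : (Fin.snoc y t : Fin (n + 2) → ℝ) ∈ D := by
        refine ⟨fun i => ?_, by simpa using ht.1⟩
        refine Fin.lastCases ?_ (fun j => ?_) i
        · simpa using (⟨(hy 0).1.trans ht.1, ht.2⟩ : t ∈ Ioo (0:ℝ) 1)
        · simpa using hy j
      rw [hΦ', indicator_of_mem hmem, indicator_of_mem ht, peakΦ_snoc]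
    · have hnot : (Fin.snoc y t : Fin (n + 2) → ℝ) ∉ D := by
        rintro ⟨h1, h2⟩
        apply ht
        refine ⟨by simpa using h2, ?_⟩
        simpa using (h1 (Fin.last (n + 1))).2
      rw [hΦ', indicator_of_notMem hnot, indicator_of_notMem ht]
  -- FTC on the fibre
  have hFTC : ∀ y ∈ cube, ∫ t in Ioo (y 0) 1, K (σ t (Fin.tail y)) / (1 - y 0) = B y := by
    intro y hy
    have hx : ∀ i, Fin.tail y i ∈ Ioo (0:ℝ) 1 := fun i => hy i.succ
    have hy0 : y 0 ∈ Ioo (0:ℝ) 1 := hy 0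
    rw [integral_div, ← integral_Ioc_eq_integral_Ioo, ← intervalIntegral.integral_of_le hy0.2.le,
      intervalIntegral.integral_eq_sub_of_hasDerivAt_of_le hy0.2.le
        ((hcontF _ hx).mono (Icc_subset_Icc hy0.1.le le_rfl))
        (fun t ht => hder _ hx t ⟨hy0.1.trans ht.1, ht.2⟩)
        (((hcontK _ hx).mono (Icc_subset_Icc hy0.1.le le_rfl)).intervalIntegrable_of_Icc hy0.2.le)]
    rw [hB, shear_one σ hσ, one_mul]
  have hinner : ∀ y, ∫⁻ t, ENNReal.ofReal (Φ' (Fin.snoc y t)) = cube.indicator (fun y => ENNReal.ofReal (B y)) y := by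
    intro y
    by_cases hy : y ∈ cube
    · rw [indicator_of_mem hy]
      have hx : ∀ i, Fin.tail y i ∈ Ioo (0:ℝ) 1 := fun i => hy i.succ
      have hy0 : y 0 ∈ Ioo (0:ℝ) 1 := hy 0
      have h1 : (fun t => ENNReal.ofReal (Φ' (Fin.snoc y t))) =
          (Ioo (y 0) 1).indicator (fun t => ENNReal.ofReal (K (σ t (Fin.tail y)) / (1 - y 0))) := by
        funext t
        rw [hfibre y hy t]
        by_cases ht : t ∈ Ioo (y 0) 1
        · rw [indicator_of_mem ht, indicator_of_mem ht]
        · rw [indicator_of_notMem ht, indicator_of_notMem ht, ENNReal.ofReal_zero]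
      have hint : IntegrableOn (fun t => K (σ t (Fin.tail y)) / (1 - y 0)) (Ioo (y 0) 1) :=
        (((hcontK _ hx).div_const (1 - y 0)).integrableOn_Icc).mono_set
          (Ioo_subset_Icc_self.trans (Icc_subset_Icc hy0.1.le le_rfl))
      have hnn : 0 ≤ᵐ[volume.restrict (Ioo (y 0) 1)] fun t => K (σ t (Fin.tail y)) / (1 - y 0) :=
        ae_restrict_of_forall_mem measurableSet_Ioo fun t ht =>
          div_nonneg (hKnn _ hx t ⟨hy0.1.le.trans ht.1.le, ht.2.le⟩) (sub_pos.mpr hy0.2).le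
      rw [h1, lintegral_indicator measurableSet_Ioo, ← ofReal_integral_eq_lintegral_ofReal hint hnn,
        hFTC y hy]
    · rw [indicator_of_notMem hy]
      have h1 : (fun t => ENNReal.ofReal (Φ' (Fin.snoc y t))) = fun _ => 0 := by
        funext t
        have hnot : (Fin.snoc y t : Fin (n + 2) → ℝ) ∉ D := by
          rintro ⟨h1, -⟩
          exact hy fun j => by simpa using h1 j.castSucc
        rw [hΦ', indicator_of_notMem hnot, ENNReal.ofReal_zero]
      rw [h1, lintegral_zero]
  -- Tonelli
  have hfin : ∫⁻ z, ENNReal.ofReal (Φ' z) < ⊤ := by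
    set e : (Fin (n + 2) → ℝ) ≃ᵐ ℝ × (Fin (n + 1) → ℝ) :=
      MeasurableEquiv.piFinSuccAbove (fun _ => ℝ) (Fin.last (n + 1)) with he_def
    have he : MeasurePreserving e volume volume :=
      volume_preserving_piFinSuccAbove (fun _ => ℝ) (Fin.last (n + 1))
    have he_symm : ∀ p : ℝ × (Fin (n + 1) → ℝ), e.symm p = Fin.snoc p.2 p.1 := fun p => by
      simp [he_def, MeasurableEquiv.piFinSuccAbove, Fin.snocEquiv]
    have hmeas : Measurable fun p : ℝ × (Fin (n + 1) → ℝ) => ENNReal.ofReal (Φ' (e.symm p)) :=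
      (hΦ'meas.comp e.symm.measurable).ennreal_ofReal
    calc ∫⁻ z, ENNReal.ofReal (Φ' z)
        = ∫⁻ p, ENNReal.ofReal (Φ' (e.symm p)) :=
          ((he.symm e).lintegral_comp_emb e.symm.measurableEmbedding (fun z => ENNReal.ofReal (Φ' z))).symm
      _ = ∫⁻ y, ∫⁻ t, ENNReal.ofReal (Φ' (e.symm (t, y))) := by
          rw [Measure.volume_eq_prod]
          exact lintegral_prod_symm _ hmeas.aemeasurable
      _ = ∫⁻ y, cube.indicator (fun y => ENNReal.ofReal (B y)) y := by
          congr 1; funext y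
          simp only [he_symm]
          exact hinner y
      _ = ∫⁻ y in cube, ENNReal.ofReal (B y) := lintegral_indicator hcube_m _
      _ ≤ ∫⁻ y in cube, ‖rB.integrand y‖ₑ := by
          refine setLIntegral_mono' hcube_m fun y hy => ?_
          have hy' : y ∈ rB.domain := by rw [hrB.1]; exact hy
          rw [show B y = rB.integrand y from (hrB.2 hy').symm]
          exact Real.ofReal_le_enorm _
      _ < ⊤ := by
          have h := rB.integrableOn
          rw [hrB.1] at h
          exact h.hasFiniteIntegral
  have hint : Integrable Φ' := by
    refine ⟨hΦ'meas.aestronglyMeasurable, ?_⟩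
    rw [HasFiniteIntegral]
    calc ∫⁻ z, ‖Φ' z‖ₑ = ∫⁻ z, ENNReal.ofReal (Φ' z) := by
          congr 1; funext z; exact (Real.enorm_eq_ofReal (hΦ'nn z))
      _ < ⊤ := hfin
  refine ⟨{ domain := D
            integrand := Φ'
            isSemialgebraic_domain := hDsa
            isSemialgebraicFunOn_integrand := hsaD.congr fun z hz => (indicator_of_mem hz _).symm
            integrableOn := hint.integrableOn }, rfl, fun z hz => indicator_of_mem hz _⟩

end Data

/-- **`stub_peakExists` of the lead's skeleton, PROVED** (type copied verbatim). -/
theorem stub_peakExists_proof : ∀ (s : List ℕ), MZV.IsAdmissible s → s ≠ [] → ∀ (f : (Fin (MZV.weight s) → ℝ) → ℝ) (K : (Fin (MZV.weight s) → ℝ) → ℝ) (σ : ℝ → (Fin (MZV.weight s) → ℝ) → (Fin (MZV.weight s) → ℝ)), (∀ (c : ℝ) (x : Fin (MZV.weight s) → ℝ) (j : Fin (MZV.weight s)), σ c x j = if (j : ℕ) = 0 then c * x j else x j) → ((∀ x : Fin (MZV.weight s) → ℝ, (∀ i, x i ∈ Set.Ioo (0:ℝ) 1) → ∀ l ∈ Set.Ioo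 (0:ℝ) 1, HasDerivAt (fun l : ℝ => l * f (σ l x)) (K (σ l x)) l) ∧ (∀ x : Fin (MZV.weight s) → ℝ, (∀ i, x i ∈ Set.Ioo (0:ℝ) 1) → ContinuousOn (fun l : ℝ => l * f (σ l x)) (Set.Icc 0 1)) ∧ (∀ x : Fin (MZV.weight s) → ℝ, (∀ i, x i ∈ Set.Ioo (0:ℝ) 1) → ContinuousOn (fun l : ℝ => K (σ l x)) (Set.Icc 0 1)) ∧ (∀ x : Fin (MZV.weight s) → ℝ, (∀ i, x i ∈ Set.Ioo (0:ℝ) 1) → ∀ l ∈ Set.Icc (0:ℝ) 1, 0 ≤ K (σ l x)) ∧ IsSemialgebraicFunOn ℚ {z : Fin (MZV.weight s + 2) → ℝ | (∀ i, Fin.init z i ∈ Set.Ioo (0:ℝ) 1) ∧ 0 ≤ z (Fin.last (MZV.weight s + 1)) ∧ z (Fin.last (MZV.weight s + 1)) ≤ 1} (fun z => K (σ (z (Fin.last (MZV.weight s + 1))) (Fin.tail (Fin.init z))) / (1 - z 0)) ∧ IsSemialgebraicFunOn ℚ {z : Fin (MZV.weight s + 2) → ℝ | (∀ i, Fin.init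 z i ∈ Set.Ioo (0:ℝ) 1) ∧ 0 ≤ z (Fin.last (MZV.weight s + 1)) ∧ z (Fin.last (MZV.weight s + 1)) ≤ 1} (fun z => z (Fin.last (MZV.weight s + 1)) * f (σ (z (Fin.last (MZV.weight s + 1))) (Fin.tail (Fin.init z))) / (1 - z 0))) → (∃ r : KZ.IntegralRep (MZV.weight s + 1), (r.domain = {y : Fin (MZV.weight s + 1) → ℝ | ∀ i, y i ∈ Set.Ioo (0:ℝ) 1} ∧ Set.EqOn r.integrand (fun y => (f (Fin.tail y) - y 0 * f (σ (y 0) (Fin.tail y))) / (1 - y 0)) r.domain)) → ∃ R : KZ.IntegralRep (MZV.weight s + 2), (R.domain = {z : Fin (MZV.weight s + 2) → ℝ | (∀ i, z i ∈ Set.Ioo (0:ℝ) 1) ∧ z 0 < z (Fin.last (MZV.weight s + 1))} ∧ Set.EqOn R.integrand (fun z => K (σ (z (Fin.last (MZV.weight s + 1))) (Fin.tail (Fin.init z))) / (1 - z 0)) R.domain) := by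
  intro s hs hne f K σ hσ hcalc hB
  obtain ⟨hder, hcontF, hcontK, hKnn, hsaK, -⟩ := hcalc
  obtain ⟨rB, hrB⟩ := hB
  exact peak_exists f K σ hσ hder hcontF hcontK hKnn hsaK rB hrB

end Summit.KontsevichZagierPeriods.KontsevichZagierPeriods.Cruxes.HoffmanRelationInKZ.DrefutePeak
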